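import Mathlib
import HarnessLib
import Summits.HubbardSuperconductivity.HubbardSuperconductivity.Theorems.KLProgrammeC4aLoopIBPWindow
import Summits.HubbardSuperconductivity.HubbardSuperconductivity.Theorems.KLProgrammeC4aFoldSignedCore

/-!
# Route `KLProgramme` — crux C4a, S3 brick (B4) «(B4)-UMK1», part 3: THE SIGNED FOLD LAW AT FIRST ORDER — across a fold of the partner band the loop-angle
# integral of `X·K′(ē)` is `O((1 + log⁺(G/t))·max(t,|ē(v*)|)^{−3/2})`, although `|K′(ē)|` alone integrates to `O(1/(t·√|ē(v*)|))` past the caustic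

Cell `gate-hubbard-kl`, seat hubbard-kl-k3c3-p3 (g27; row «implicit-function / monotonicity route for μ(n)»).  Located brick for the (C)-closer lane
hubbard-kl-c4a-1 (stub (C) `stub_twoLeg_curvature` of `KLRegimeEngineV17F2`, stmt-HubbardSuperconductivity-20437), design note HOME/hubbard-kl-k3c3-p3/B4-UMK1-DESIGN.md
§3–§4 (b): the umklapp FIRST-ORDER jet is not an absolute-value estimate past the caustic (two small-angle crossings); the cure is the cancellation inside
`∫ X·K′(g) = ∫ (X/g′)·d[K(g)]` on the monotone branches.  SETTING (carrier-free): a loop window `[α,β]` with a FOLD POINT `v*` (`g′(v*) = 0`) of `g ∈ C²`,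
`c₂ ≤ g″`, `|g″| ≤ L₂`, `|g| ≤ G` on the window; a kernel `K ∈ C¹` with the ENVELOPES `|K(u)| ≤ 1/max(t,|u|)`, `|K′(u)| ≤ 1/max(t,|u|)²` (`t > 0` = the scale
floor, `≥` the finer level); a weight `X ∈ C¹`, `|X| ≤ X₀`, `|X′| ≤ X₁`, VANISHING AT THE WINDOW ENDS (partition-of-unity piece).  With `m = g(v*)`,
`M = max(t,|m|)`, `η = √M/(2√L₂)` (so `L₂η² = M/4`), `σ = c₂η`:
* §1 `abs_intervalIntegral_mul_deriv_comp_le_ends` — part 1's window estimate keeping the end values `|X(α)|, |X(β)|`;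
* §2 core facts: on `|v − v*| ≤ η` the band stays in `|g − m| ≤ M/4`, whence `1/max(t,|g|) ≤ 2/M`;
* §3 **`abs_intervalIntegral_mul_deriv_comp_le_fold`** (THE SIGNED FOLD LAW):
  `|∫_{α..β} X·K′(g)| ≤ 8ηX₀/M² + 2·(4X₀/(Mσ) + (X₁/σ + X₀L₂/σ²)·σ⁻¹·(2 + 4log⁺(G/t)))`
  — i.e. `≤ C(X₀,X₁,c₂,L₂)·(1 + log⁺(G/t))·M^{−3/2} + C′X₁(1 + log⁺(G/t))·M^{−1}` (`η/M² = 1/(2√L₂M^{3/2})`, `1/(Mσ) = 2√L₂/(c₂M^{3/2})`, `σ^{−3} ∝ M^{−3/2}`, `σ^{−2} ∝ M^{−1}`):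
  CORE `|v − v*| ≤ η` by absolute values (`|K′(g)| ≤ 4/M²`), OUTER branches by part 1's IBP (slope `≥ σ` by part 2, inner boundary `|K| ≤ 2/M`, outer boundary
  killed by `X = 0`, remainder `≤ (X₁/σ + X₀L₂/σ²)·∫|K(g)| ≤ (…)·σ⁻¹(2 + 4log⁺(G/t))` by part 2's monotone substitution).
The level integral of `max(e,|ē_min(e)|)^{−3/2}` (`ē_min(e) ≈ δ₀ − e`) is `≍ |δ₀|^{−1/2}` and `lo`-free (design note §4 (b)–(d)): typed next.  Pure real analysis.
References: Salmhofer 1999 §4.5.3 Lemma 4.10 (tangential case) [cite: Salmhofer1999]; FST II CPAM 51 (1998) §3 [cite: FeldmanSalmhoferTrubowitz1998].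
-/

noncomputable section

namespace Summit.HubbardSuperconductivity.HubbardSuperconductivity.Theorems.C4a

set_option linter.dupNamespace false -- summit = problem name (single-conjunct summit), D-0017

open Real Set MeasureTheory intervalIntegral

variable {g X K : ℝ → ℝ}

/-! ## §1 The window estimate with the end values of the weight -/

/-- Part 1's window estimate with the END VALUES kept: `|∫_{a..b} X·K′(g)| ≤ (|X a|·|K(g a)| + |X b|·|K(g b)|)/σ + (X₁/σ + X₀L₂/σ²)·∫_{a..b}|K(g)|`. -/
theorem abs_intervalIntegral_mul_deriv_comp_le_ends {a b : ℝ} (hab : a ≤ b) (hg : ContDiff ℝ 2 g) (hX : ContDiff ℝ 1 X) (hK : ContDiff ℝ 1 K)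
    {σ L₂ X₀ X₁ : ℝ} (hσ : 0 < σ) (hgσ : ∀ v ∈ Icc a b, σ ≤ |deriv g v|) (hL₂ : ∀ v ∈ Icc a b, |iteratedDeriv 2 g v| ≤ L₂)
    (hX₀ : ∀ v ∈ Icc a b, |X v| ≤ X₀) (hX₁ : ∀ v ∈ Icc a b, |deriv X v| ≤ X₁) :
    |∫ v in a..b, X v * deriv K (g v)| ≤
      (|X a| * |K (g a)| + |X b| * |K (g b)|) / σ + (X₁ / σ + X₀ * L₂ / σ ^ 2) * ∫ v in a..b, |K (g v)| := by
  have hg' : ∀ s ∈ Icc a b, deriv g s ≠ 0 := fun s hs h0 => by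
    have := hgσ s hs; rw [h0, abs_zero] at this; linarith
  have ha : a ∈ Icc a b := left_mem_Icc.2 hab
  have hb : b ∈ Icc a b := right_mem_Icc.2 hab
  have hX₀0 : 0 ≤ X₀ := (abs_nonneg _).trans (hX₀ a ha)
  have hX₁0 : 0 ≤ X₁ := (abs_nonneg _).trans (hX₁ a ha)
  have hL₂0 : 0 ≤ L₂ := (abs_nonneg _).trans (hL₂ a ha)
  rw [intervalIntegral_mul_deriv_comp_eq_boundary_sub hab hg hg' hX hK]
  have hbd : ∀ v ∈ Icc a b, |X v / deriv g v * K (g v)| ≤ |X v| * |K (g v)| / σ := fun v hv => by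
    rw [abs_mul, abs_div]
    have h1 : |X v| / |deriv g v| ≤ |X v| / σ := div_le_div_of_nonneg_left (abs_nonneg _) hσ (hgσ v hv)
    calc |X v| / |deriv g v| * |K (g v)| ≤ |X v| / σ * |K (g v)| := mul_le_mul_of_nonneg_right h1 (abs_nonneg _)
      _ = |X v| * |K (g v)| / σ := by ring
  have hint : |∫ v in a..b, (deriv X v * deriv g v - X v * iteratedDeriv 2 g v) / deriv g v ^ 2 * K (g v)| ≤
      (X₁ / σ + X₀ * L₂ / σ ^ 2) * ∫ v in a..b, |K (g v)| := by
    rw [← intervalIntegral.integral_const_mul]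
    refine (intervalIntegral.abs_integral_le_integral_abs hab).trans (intervalIntegral.integral_mono_on hab ?_ ?_ fun v hv => ?_)
    · have hgc : Continuous (deriv g) := hg.continuous_deriv (by norm_num)
      have hu'c : ContinuousOn (fun x => (deriv X x * deriv g x - X x * iteratedDeriv 2 g x) / deriv g x ^ 2 * K (g x)) (uIcc a b) := by
        refine (ContinuousOn.div ?_ ?_ fun x hx => pow_ne_zero 2 (hg' x ((uIcc_of_le hab) ▸ hx))).mul
          (hK.continuous.comp hg.continuous).continuousOn
        · exact (((hX.continuous_deriv le_rfl).mul hgc).sub (hX.continuous.mul (hg.continuous_iteratedDeriv 2 le_rfl))).continuousOn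
        · exact (hgc.pow 2).continuousOn
      exact hu'c.intervalIntegrable.abs
    · exact ((hK.continuous.comp hg.continuous).abs.intervalIntegrable a b).const_mul _
    · rw [abs_mul, abs_div, abs_pow]
      have hgv := hgσ v hv
      have hgpos : 0 < |deriv g v| := hσ.trans_le hgv
      have hnum : |deriv X v * deriv g v - X v * iteratedDeriv 2 g v| ≤ X₁ * |deriv g v| + X₀ * L₂ := by
        refine (abs_sub _ _).trans (add_le_add ?_ ?_)
        · rw [abs_mul]; exact mul_le_mul_of_nonneg_right (hX₁ v hv) (abs_nonneg _)
        · rw [abs_mul]; exact mul_le_mul (hX₀ v hv) (hL₂ v hv) (abs_nonneg _) hX₀0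
      have h1 : |deriv X v * deriv g v - X v * iteratedDeriv 2 g v| / |deriv g v| ^ 2 ≤ X₁ / σ + X₀ * L₂ / σ ^ 2 := by
        rw [div_le_iff₀ (by positivity)]
        have e1 : X₁ * |deriv g v| ≤ X₁ / σ * |deriv g v| ^ 2 := by
          rw [div_mul_eq_mul_div, le_div_iff₀ hσ]; nlinarith [mul_nonneg hX₁0 (abs_nonneg (deriv g v))]
        have e2 : X₀ * L₂ ≤ X₀ * L₂ / σ ^ 2 * |deriv g v| ^ 2 := by
          rw [div_mul_eq_mul_div, le_div_iff₀ (by positivity)]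
          have := mul_le_mul hgv hgv hσ.le (abs_nonneg _)
          nlinarith [mul_nonneg hX₀0 hL₂0]
        nlinarith
      exact mul_le_mul_of_nonneg_right h1 (abs_nonneg _)
  have h1 := hbd a ha
  have h2 := hbd b hb
  calc |X b / deriv g b * K (g b) - X a / deriv g a * K (g a) -
          ∫ v in a..b, (deriv X v * deriv g v - X v * iteratedDeriv 2 g v) / deriv g v ^ 2 * K (g v)|
      ≤ |X b / deriv g b * K (g b)| + |X a / deriv g a * K (g a)| +
          |∫ v in a..b, (deriv X v * deriv g v - X v * iteratedDeriv 2 g v) / deriv g v ^ 2 * K (g v)| :=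
        (abs_sub _ _).trans (add_le_add (abs_sub _ _) le_rfl)
    _ ≤ |X b| * |K (g b)| / σ + |X a| * |K (g a)| / σ + (X₁ / σ + X₀ * L₂ / σ ^ 2) * ∫ v in a..b, |K (g v)| :=
        add_le_add (add_le_add h2 h1) hint
    _ = (|X a| * |K (g a)| + |X b| * |K (g b)|) / σ + (X₁ / σ + X₀ * L₂ / σ ^ 2) * ∫ v in a..b, |K (g v)| := by ring

/-! ## §2 The core band around the fold point -/

/-- In the core `|v − v*| ≤ η` with `L₂η² ≤ M/4` (`M = max(t,|g v*|)`) the envelope is `≤ 2/M`. -/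
theorem inv_envelope_le_of_core {t m gv M δ : ℝ} (ht : 0 < t) (hM : M = max t |m|) (hband : |gv - m| ≤ δ) (hδ : δ ≤ M / 4) :
    (max t |gv|)⁻¹ ≤ 2 / M := by
  have hMpos : 0 < M := by rw [hM]; exact lt_max_of_lt_left ht
  have hmax : M / 2 ≤ max t |gv| := by
    rcases le_or_gt |m| t with h | h
    · have : M = t := by rw [hM, max_eq_left h]
      rw [this]; linarith [le_max_left t |gv|, ht]
    · have : M = |m| := by rw [hM, max_eq_right h.le]
      have h2 : |m| - δ ≤ |gv| := by
        have := abs_sub_abs_le_abs_sub m gv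
        rw [abs_sub_comm] at this
        linarith
      rw [this] at hδ ⊢
      linarith [le_max_right t |gv|]
  rw [div_eq_mul_inv, show (2 : ℝ) * M⁻¹ = (M / 2)⁻¹ by rw [inv_div]; ring]
  exact inv_anti₀ (half_pos hMpos) hmax

/-! ## §3 The signed fold law -/

/-- **THE SIGNED FOLD LAW AT FIRST ORDER.**  Window `[α,β]`, fold point `v* ∈ [α,β]` (`g′(v*) = 0`), `g ∈ C²` with `c₂ ≤ g″` and `|g″| ≤ L₂` on `[α,β]`
(`0 < c₂`), `|g| ≤ G`; kernel `K ∈ C¹` with `|K(u)| ≤ 1/max(t,|u|)`, `|K′(u)| ≤ 1/max(t,|u|)²` (`t > 0`); weight `X ∈ C¹`, `|X| ≤ X₀`, `|X′| ≤ X₁` on `[α,β]`,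
`X(α) = X(β) = 0`.  With `M = max(t,|g v*|)`, `η = √M/(2√L₂)`, `σ = c₂η`:
`|∫_{α..β} X·K′(g)| ≤ 8ηX₀/M² + 2·(4X₀/(Mσ) + (X₁/σ + X₀L₂/σ²)·σ⁻¹·(2 + 4log⁺(G/t)))` — of order `(1 + log⁺(G/t))·M^{−3/2}`: NO `1/t`.
[cite: Salmhofer1999, §4.5.3 Lemma 4.10; FeldmanSalmhoferTrubowitz1998, §3] -/
theorem abs_intervalIntegral_mul_deriv_comp_le_fold {α β vs c₂ L₂ G t X₀ X₁ : ℝ} (hvs : vs ∈ Icc α β)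
    (hg : ContDiff ℝ 2 g) (hcrit : deriv g vs = 0) (hc₂ : 0 < c₂) (hfloor : ∀ v ∈ Icc α β, c₂ ≤ iteratedDeriv 2 g v)
    (hL₂ : ∀ v ∈ Icc α β, |iteratedDeriv 2 g v| ≤ L₂) (hG : 0 < G) (hgG : ∀ v ∈ Icc α β, |g v| ≤ G)
    (hK : ContDiff ℝ 1 K) (ht : 0 < t) (hK0 : ∀ u, |K u| ≤ (max t |u|)⁻¹) (hK1 : ∀ u, |deriv K u| ≤ (max t |u|)⁻¹ ^ 2)
    (hX : ContDiff ℝ 1 X) (hX₀ : ∀ v ∈ Icc α β, |X v| ≤ X₀) (hX₁ : ∀ v ∈ Icc α β, |deriv X v| ≤ X₁) (hXα : X α = 0) (hXβ : X β = 0) :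
    |∫ v in α..β, X v * deriv K (g v)| ≤
      8 * (Real.sqrt (max t |g vs|) / (2 * Real.sqrt L₂)) * X₀ / (max t |g vs|) ^ 2 +
        2 * (4 * X₀ / (max t |g vs| * (c₂ * (Real.sqrt (max t |g vs|) / (2 * Real.sqrt L₂)))) +
          (X₁ / (c₂ * (Real.sqrt (max t |g vs|) / (2 * Real.sqrt L₂))) +
              X₀ * L₂ / (c₂ * (Real.sqrt (max t |g vs|) / (2 * Real.sqrt L₂))) ^ 2) *
            ((c₂ * (Real.sqrt (max t |g vs|) / (2 * Real.sqrt L₂)))⁻¹ * (2 + 4 * log⁺ (G / t)))) := by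
  -- constants
  obtain ⟨M, hM⟩ : ∃ M : ℝ, M = max t |g vs| := ⟨_, rfl⟩
  have hMpos : 0 < M := by rw [hM]; exact lt_max_of_lt_left ht
  have hL₂c : c₂ ≤ L₂ := (le_abs_self _).trans' (hfloor vs hvs) |>.trans (hL₂ vs hvs)
  have hL₂pos : 0 < L₂ := hc₂.trans_le hL₂c
  obtain ⟨η, hη⟩ : ∃ η : ℝ, η = Real.sqrt M / (2 * Real.sqrt L₂) := ⟨_, rfl⟩
  have hsL : 0 < Real.sqrt L₂ := Real.sqrt_pos.2 hL₂pos
  have hsM : 0 < Real.sqrt M := Real.sqrt_pos.2 hMpos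
  have hηpos : 0 < η := by rw [hη]; positivity
  have hη2 : L₂ * η ^ 2 = M / 4 := by
    rw [hη, div_pow, mul_pow, Real.sq_sqrt hMpos.le, Real.sq_sqrt hL₂pos.le]; field_simp; norm_num
  obtain ⟨σ, hσ⟩ : ∃ σ : ℝ, σ = c₂ * η := ⟨_, rfl⟩
  have hσpos : 0 < σ := by rw [hσ]; positivity
  have hX₀0 : 0 ≤ X₀ := (abs_nonneg _).trans (hX₀ vs hvs)
  have hX₁0 : 0 ≤ X₁ := (abs_nonneg _).trans (hX₁ vs hvs)
  rw [← hM, ← hη, ← hσ]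
  -- the integrand is continuous
  have hFc : Continuous fun v => X v * deriv K (g v) := hX.continuous.mul ((hK.continuous_deriv le_rfl).comp hg.continuous)
  have hFi : ∀ p q : ℝ, IntervalIntegrable (fun v => X v * deriv K (g v)) volume p q := fun p q => hFc.intervalIntegrable p q
  -- split points
  obtain ⟨a₁, ha₁⟩ : ∃ a₁ : ℝ, a₁ = max α (vs - η) := ⟨_, rfl⟩
  obtain ⟨b₁, hb₁⟩ : ∃ b₁ : ℝ, b₁ = min β (vs + η) := ⟨_, rfl⟩
  have hαa₁ : α ≤ a₁ := by rw [ha₁]; exact le_max_left _ _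
  have ha₁vs : a₁ ≤ vs := by rw [ha₁]; exact max_le hvs.1 (by linarith)
  have hvsb₁ : vs ≤ b₁ := by rw [hb₁]; exact le_min hvs.2 (by linarith)
  have hb₁β : b₁ ≤ β := by rw [hb₁]; exact min_le_left _ _
  have ha₁c : vs - η ≤ a₁ := by rw [ha₁]; exact le_max_right _ _
  have hb₁c : b₁ ≤ vs + η := by rw [hb₁]; exact min_le_right _ _
  have hsplit : ∫ v in α..β, X v * deriv K (g v) =
      (∫ v in α..a₁, X v * deriv K (g v)) + (∫ v in a₁..b₁, X v * deriv K (g v)) + ∫ v in b₁..β, X v * deriv K (g v) := by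
    rw [intervalIntegral.integral_add_adjacent_intervals (hFi _ _) (hFi _ _), intervalIntegral.integral_add_adjacent_intervals (hFi _ _) (hFi _ _)]
  -- the core band: `|g v − m| ≤ M/4` for `|v − v*| ≤ η`
  have hcore : ∀ v ∈ Icc α β, |v - vs| ≤ η → (max t |g v|)⁻¹ ≤ 2 / M := fun v hv hvη => by
    have hband : |g v - g vs| ≤ L₂ * η ^ 2 := by
      refine (abs_sub_le_of_fold hg hvs hcrit hL₂ hv).trans ?_
      have : |v - vs| ^ 2 ≤ η ^ 2 := pow_le_pow_left₀ (abs_nonneg _) hvη 2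
      exact mul_le_mul_of_nonneg_left this hL₂pos.le
    exact inv_envelope_le_of_core ht hM hband (by rw [hη2])
  -- (1) the core integral
  have hI₂ : |∫ v in a₁..b₁, X v * deriv K (g v)| ≤ 8 * η * X₀ / M ^ 2 := by
    have hpt : ∀ v ∈ Set.uIoc a₁ b₁, ‖X v * deriv K (g v)‖ ≤ X₀ * (2 / M) ^ 2 := fun v hv => by
      rw [Set.uIoc_of_le (ha₁vs.trans hvsb₁)] at hv
      have hvI : v ∈ Icc α β := ⟨hαa₁.trans hv.1.le, hv.2.trans hb₁β⟩
      have hvη : |v - vs| ≤ η := abs_le.2 ⟨by linarith [hv.1], by linarith [hv.2]⟩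
      rw [Real.norm_eq_abs, abs_mul]
      have h1 := hcore v hvI hvη
      have h2 : |deriv K (g v)| ≤ (2 / M) ^ 2 :=
        (hK1 (g v)).trans (pow_le_pow_left₀ (inv_nonneg.2 (le_max_of_le_left ht.le)) h1 2)
      exact mul_le_mul (hX₀ v hvI) h2 (abs_nonneg _) hX₀0
    have h := intervalIntegral.norm_integral_le_of_norm_le_const hpt
    rw [Real.norm_eq_abs, abs_of_nonneg (by linarith : 0 ≤ b₁ - a₁)] at h
    refine h.trans ?_
    have hlen : b₁ - a₁ ≤ 2 * η := by linarith
    calc X₀ * (2 / M) ^ 2 * (b₁ - a₁) ≤ X₀ * (2 / M) ^ 2 * (2 * η) := mul_le_mul_of_nonneg_left hlen (by positivity)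
      _ = 8 * η * X₀ / M ^ 2 := by field_simp; ring
  -- (2) an outer branch `[p,q] ⊆ [α,β]` at distance `≥ η` from `v*`, with `X = 0` at its outer end
  have houter : ∀ p q : ℝ, α ≤ p → q ≤ β → p ≤ q → (∀ v ∈ Icc p q, η ≤ |v - vs|) →
      (X p = 0 ∨ |p - vs| = η) → (X q = 0 ∨ |q - vs| = η) →
      |∫ v in p..q, X v * deriv K (g v)| ≤ 4 * X₀ / (M * σ) + (X₁ / σ + X₀ * L₂ / σ ^ 2) * (σ⁻¹ * (2 + 4 * log⁺ (G / t))) := by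
    intro p q hαp hqβ hpq hfar hp hq
    have hsub : ∀ v ∈ Icc p q, v ∈ Icc α β := fun v hv => ⟨hαp.trans hv.1, hv.2.trans hqβ⟩
    have hslope : ∀ v ∈ Icc p q, σ ≤ |deriv g v| := fun v hv => by
      rw [hσ]
      exact (mul_le_mul_of_nonneg_left (hfar v hv) hc₂.le).trans (abs_deriv_ge_of_fold hg hvs hcrit hfloor (hsub v hv))
    have hest := abs_intervalIntegral_mul_deriv_comp_le_ends hpq hg hX hK hσpos hslope (fun v hv => hL₂ v (hsub v hv))
      (fun v hv => hX₀ v (hsub v hv)) fun v hv => hX₁ v (hsub v hv)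
    -- the end values: either `X = 0` or the point is on the core boundary where the envelope is `≤ 2/M`
    have hend : ∀ r ∈ Icc p q, (X r = 0 ∨ |r - vs| = η) → |X r| * |K (g r)| ≤ X₀ * (2 / M) := by
      intro r hr hr'
      rcases hr' with h0 | hη'
      · rw [h0, abs_zero, zero_mul]; positivity
      · have h1 := hcore r (hsub r hr) hη'.le
        exact mul_le_mul (hX₀ r (hsub r hr)) ((hK0 (g r)).trans h1) (abs_nonneg _) hX₀0
    have hends : (|X p| * |K (g p)| + |X q| * |K (g q)|) / σ ≤ 4 * X₀ / (M * σ) := by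
      have h1 := hend p (left_mem_Icc.2 hpq) hp
      have h2 := hend q (right_mem_Icc.2 hpq) hq
      rw [div_le_iff₀ hσpos]
      have e : 4 * X₀ / (M * σ) * σ = X₀ * (2 / M) + X₀ * (2 / M) := by
        field_simp
        ring
      rw [e]; exact add_le_add h1 h2
    -- the remainder: monotone substitution to the level
    have hrem : ∫ v in p..q, |K (g v)| ≤ σ⁻¹ * (2 + 4 * log⁺ (G / t)) := by
      have h1 : ∫ v in p..q, |K (g v)| ≤ ∫ v in p..q, (max t |g v|)⁻¹ :=
        intervalIntegral.integral_mono_on hpq ((hK.continuous.comp hg.continuous).abs.intervalIntegrable p q)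
          ((continuous_inv_envelope (g := g) hg.continuous ht).intervalIntegrable p q) fun v _ => hK0 (g v)
      exact h1.trans (intervalIntegral_inv_envelope_comp_le_of_slope hpq (hg.of_le (by norm_num)) hσpos hslope ht hG fun v hv => hgG v (hsub v hv))
    have hcoef : 0 ≤ X₁ / σ + X₀ * L₂ / σ ^ 2 := by positivity
    exact hest.trans (add_le_add hends (mul_le_mul_of_nonneg_left hrem hcoef))
  -- (3) the two outer branches (possibly degenerate)
  have hposlog : 0 ≤ log⁺ (G / t) := Real.posLog_nonneg
  have hRHS0 : 0 ≤ 4 * X₀ / (M * σ) + (X₁ / σ + X₀ * L₂ / σ ^ 2) * (σ⁻¹ * (2 + 4 * log⁺ (G / t))) := by positivity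
  have hI₁ : |∫ v in α..a₁, X v * deriv K (g v)| ≤ 4 * X₀ / (M * σ) + (X₁ / σ + X₀ * L₂ / σ ^ 2) * (σ⁻¹ * (2 + 4 * log⁺ (G / t))) := by
    rcases le_total α (vs - η) with h1 | h1
    · have ha : a₁ = vs - η := by rw [ha₁, max_eq_right h1]
      refine houter α a₁ le_rfl (ha₁vs.trans (hvsb₁.trans hb₁β)) hαa₁ (fun v hv => ?_) (Or.inl hXα) (Or.inr ?_)
      · rw [ha] at hv
        rw [abs_of_nonpos (by linarith [hv.2, hηpos])]; linarith [hv.2]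
      · rw [ha, abs_of_nonpos (by linarith)]; ring
    · have ha : a₁ = α := by rw [ha₁, max_eq_left h1]
      rw [ha, intervalIntegral.integral_same, abs_zero]; exact hRHS0
  have hI₃ : |∫ v in b₁..β, X v * deriv K (g v)| ≤ 4 * X₀ / (M * σ) + (X₁ / σ + X₀ * L₂ / σ ^ 2) * (σ⁻¹ * (2 + 4 * log⁺ (G / t))) := by
    rcases le_total (vs + η) β with h1 | h1
    · have hb : b₁ = vs + η := by rw [hb₁, min_eq_right h1]
      refine houter b₁ β (hαa₁.trans (ha₁vs.trans hvsb₁)) le_rfl hb₁β (fun v hv => ?_) (Or.inr ?_) (Or.inl hXβ)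
      · rw [hb] at hv
        rw [abs_of_nonneg (by linarith [hv.1, hηpos])]; linarith [hv.1]
      · rw [hb, abs_of_nonneg (by linarith)]; ring
    · have hb : b₁ = β := by rw [hb₁, min_eq_left h1]
      rw [hb, intervalIntegral.integral_same, abs_zero]; exact hRHS0
  -- (4) sum
  rw [hsplit]
  calc |(∫ v in α..a₁, X v * deriv K (g v)) + (∫ v in a₁..b₁, X v * deriv K (g v)) + ∫ v in b₁..β, X v * deriv K (g v)|
      ≤ |∫ v in α..a₁, X v * deriv K (g v)| + |∫ v in a₁..b₁, X v * deriv K (g v)| + |∫ v in b₁..β, X v * deriv K (g v)| :=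
        (abs_add_le _ _).trans (add_le_add (abs_add_le _ _) le_rfl)
    _ ≤ (4 * X₀ / (M * σ) + (X₁ / σ + X₀ * L₂ / σ ^ 2) * (σ⁻¹ * (2 + 4 * log⁺ (G / t)))) + 8 * η * X₀ / M ^ 2 +
          (4 * X₀ / (M * σ) + (X₁ / σ + X₀ * L₂ / σ ^ 2) * (σ⁻¹ * (2 + 4 * log⁺ (G / t)))) := add_le_add (add_le_add hI₁ hI₂) hI₃
    _ = 8 * η * X₀ / M ^ 2 + 2 * (4 * X₀ / (M * σ) + (X₁ / σ + X₀ * L₂ / σ ^ 2) * (σ⁻¹ * (2 + 4 * log⁺ (G / t)))) := by ring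

end Summit.HubbardSuperconductivity.HubbardSuperconductivity.Theorems.C4a

end
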